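import Mathlib
import Literature.Geometry.Lorentzian.KerrConvergence
import Literature.Geometry.Lorentzian.ShellDeviation
import Summits.FinalStateConjecture.FinalStateConjecture.Statement
import HarnessLib

/-!
# Sketch — crux-ideate r1 k3, crux `StarvedNecks.NecksCertify` (stmt-FinalStateConjecture-13549)

First lemmas of the two idea cards of ideator 3 (planner-cruxidea-stmt-FinalStateConjecture-13549-3-0):

* card `summable-incoming-ledger`: `WeightedWallStarvation` (the line's first checkable
  statement = its Transfer target) and its elementary engines `SummableLedgerTail`,
  `RadiatedEnergyKernel`;
* card `sojourn-egorov-scale-free-neck`: `NeckContractionSchema` (what the lever delivers, as an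
  inequality schema), its real-analysis closure `ContractionForcesDecay`, and the geometric engine
  `FarZoneSingleTurningPoint` (no trapping beyond `3M`: one turning point, sojourn ≤ two crossings).

Nothing is proved here; every `def … : Prop` only has to elaborate.
-/

noncomputable section

open scoped Topology ENNReal Manifold ContDiff
open Filter Set MeasureTheory Literature.Geometry.Lorentzian

namespace Summit.FinalStateConjecture.FinalStateConjecture.Cruxes.NecksCertify.IdeateR1K3

/-! ### Card 1 — `summable-incoming-ledger` -/

/-- **Weighted wall starvation** (Transfer target `C⁺₁` of card `summable-incoming-ledger`):
for a `C⁴` final-state decomposition `d` of a region `O` and every hole `i`, there are a FATTENED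
sublinear wall profile `ρ′ ≥ ρᵢ` with `ρ′ → ∞` and a re-gauged late flat chart `Φ′` on the same
flat domain such that the SCALE-INVARIANT `C³` deviation of `Φ′^* g` from `η` on the flat-time
shells `{y⁰ = τ, ρ′(τ) ≤ rᵢ(y) ≤ 4ρ′(τ)}` around hole `i`'s straight world-line tends to `0`
(`scaleCkENorm` at scale `ρ′(τ)`; `rᵢ` = rest-frame Kerr–Schild radius of `d.background i`).
This is exactly the input that beats the focusing loss `ρ′/b` of wall-borne glancing content. -/
def WeightedWallStarvation : Prop :=
  ∀ (X : Type) [TopologicalSpace X] [ChartedSpace E3 X] [IsManifold (𝓡 3) ∞ X] [ConnectedSpace X]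
    (D : InitialDataSet (𝓡 3) X), D ∈ admissibleVacuumData X →
    ∀ 𝒟 : VacuumCauchyDevelopment D, 𝒟.IsMaximal →
    ∀ (O : Set 𝒟.carrier) (d : FinalStateDecomposition 𝒟.toSpacetime O 4),
      O = Summit.FinalStateConjecture.exteriorOf 𝒟.toCauchyDevelopment d.charted →
      (∀ i, Kerr.IsSubextremal (d.mass i) (d.spin i)) →
      ∀ i : Fin d.N, ∃ (ρ' : ℝ → ℝ) (Φ' : d.flatDomain → 𝒟.carrier),
        (∀ t, d.excision i t ≤ ρ' t) ∧ Tendsto ρ' atTop atTop ∧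
        Tendsto (fun t ↦ ρ' t / t) atTop (𝓝 0) ∧
        𝒟.toSpacetime.IsLateChart (Minkowski.backgroundOn d.flatDomain) O d.τ₀ Φ' ∧
        Tendsto (fun τ ↦ scaleCkENorm
            (Subtype.val '' {y : d.flatDomain | y.1 0 = τ ∧ ρ' τ ≤ (d.background i).radius y.1 ∧
                (d.background i).radius y.1 ≤ 4 * ρ' τ})
            3 (ρ' τ) (𝒟.toSpacetime.deviationExtend (Minkowski.backgroundOn d.flatDomain) Φ'))
          atTop (𝓝 0)

/-- **Summable ledger tail** (engine of the incoming-cone ledger): a source entering the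
`∇₃`-transport of the weighted incoming pair at weight `≤ B / r²` contributes at most `B / ρ`
between the wall radius `ρ` and any outer radius `R` — no decay RATE in time is used, only
summability in `r`. -/
def SummableLedgerTail : Prop :=
  ∀ (B ρ R : ℝ) (f : ℝ → ℝ), 0 < ρ → ρ ≤ R → 0 ≤ B →
    IntervalIntegrable f volume ρ R → (∀ r ∈ Icc ρ R, |f r| ≤ B / r ^ 2) →
    |∫ r in ρ..R, f r| ≤ B / ρ

/-- **Radiated-energy kernel** (engine for the radiative quadratic sources): if the radiated
power `g ≥ 0` (per solid angle) is integrable on `[0, ∞)` — finite total radiated energy, from the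
Bondi mass-loss formula and boundedness of the Bondi mass — and the wall recedes, `ρ(v) → ∞` with
`4ρ(v) ≤ v` eventually, then the history integral against the backscatter kernel `1/(v − u)`
over retarded times `u ≤ v − 2ρ(v)` tends to `0` as the advanced time `v → ∞`
(split at `v/2`: `(2/v)·∫g` plus `(2ρ)⁻¹ ∫_{v/2}^∞ g`). -/
def RadiatedEnergyKernel : Prop :=
  ∀ (g ρ : ℝ → ℝ), (∀ u, 0 ≤ g u) → IntegrableOn g (Ici 0) volume →
    Tendsto ρ atTop atTop → (∀ᶠ v in atTop, 4 * ρ v ≤ v) →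
    Tendsto (fun v ↦ ∫ u in (0 : ℝ)..(v - 2 * ρ v), g u / (v - u)) atTop (𝓝 0)

/-! ### Card 2 — `sojourn-egorov-scale-free-neck` -/

/-- **Neck contraction schema** (what the sojourn–Egorov lever delivers, hole by hole): for a
decomposition `d`, a hole `i`, an inner certified profile `Rg` and a fattened wall `ρ′`, and an
input functional `W` (weighted wall starvation + cylinder certificate over the last three
crossing times), the scale-invariant `C²` shell deviation of (a re-gauging of) the hole chart on
the neck `{Rg(τ) ≤ rᵢ ≤ ρ′(τ)}` is bounded by the inputs plus HALF of its own sup over the last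
three crossing times — uniformly in angular frequency, because every null bicharacteristic leaves
the neck within two crossings (no trapping on `r ≥ 100M`) and the neck geometry is scale-invariantly
`(M/R₀)`-close to Minkowski. -/
def NeckContractionSchema : Prop :=
  ∀ (X : Type) [TopologicalSpace X] [ChartedSpace E3 X] [IsManifold (𝓡 3) ∞ X] [ConnectedSpace X]
    (D : InitialDataSet (𝓡 3) X), D ∈ admissibleVacuumData X →
    ∀ 𝒟 : VacuumCauchyDevelopment D, 𝒟.IsMaximal →
    ∀ (O : Set 𝒟.carrier) (d : FinalStateDecomposition 𝒟.toSpacetime O 4) (i : Fin d.N)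
      (Rg ρ' W : ℝ → ℝ),
      O = Summit.FinalStateConjecture.exteriorOf 𝒟.toCauchyDevelopment d.charted →
      Kerr.IsSubextremal (d.mass i) (d.spin i) →
      (∀ τ, 100 * d.mass i ≤ Rg τ ∧ Rg τ ≤ ρ' τ ∧ d.excision i τ ≤ ρ' τ) →
      Tendsto (fun t ↦ ρ' t / t) atTop (𝓝 0) →
      -- `W` dominates the weighted wall input on `[ρ′, 4ρ′]` and the cylinder certificate at `Rg`
      -- over the window `[τ − 3ρ′(τ), τ]` (left abstract here; the line card fixes it)
      ∃ (Ψ' : (d.background i).domain → 𝒟.carrier) (T : ℝ),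
        𝒟.toSpacetime.IsLateChart (d.background i) O d.τ₀ Ψ' ∧
        -- the neck norm: sup over the dyadic shells inside `[Rg s, ρ′ s]` of the scale-invariant
        -- `C²` shell deviation (weight `(2ʲ)ᵐ` on the `m`-th derivative — focusing-invariant)
        let nn : ℝ → ℝ := fun s ↦ (⨆ (j : ℤ) (_ : Rg s ≤ (2 : ℝ) ^ j ∧ (2 : ℝ) ^ (j + 1) ≤ ρ' s),
          𝒟.toSpacetime.dyadicShellDeviationCk (d.background i) Ψ' 2 j s).toReal
        ∀ τ, T ≤ τ → nn τ ≤ W τ + (1 / 2) * sSup (nn '' Icc (τ - 3 * ρ' τ) τ)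

/-- **Contraction forces decay** (real-analysis closure of the schema): a bounded non-negative
`f` with `f(τ) ≤ a(τ) + ½ sup_{[τ − L(τ), τ]} f`, `a → 0`, `0 ≤ L(τ) ≤ τ/2`, tends to `0`
(`F(τ) := sup_{s ≥ τ} f(s)` satisfies `F(τ) ≤ sup_{s ≥ τ} a(s) + ½ F(τ/2)`). -/
def ContractionForcesDecay : Prop :=
  ∀ (f a L : ℝ → ℝ) (C : ℝ), (∀ τ, 0 ≤ f τ ∧ f τ ≤ C) → Tendsto a atTop (𝓝 0) →
    (∀ τ, 1 ≤ τ → 0 ≤ L τ ∧ L τ ≤ τ / 2) →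
    (∀ τ, 1 ≤ τ → f τ ≤ a τ + (1 / 2) * sSup (f '' Icc (τ - L τ) τ)) →
    Tendsto f atTop (𝓝 0)

/-- **Far-zone single turning point** (geometric engine: no trapping beyond the photon sphere):
the Schwarzschild radial null potential `P_b(r) = 1 − b²/r² + 2Mb²/r³` (`(dr/dλ)² = P_b(r)` for
impact parameter `b`) is strictly increasing on `r > 3M`; hence a null geodesic in `{r ≥ R₀}`,
`R₀ > 3M`, has at most one turning point and sojourns in `{R₀ ≤ r ≤ ρ}` for at most two radial
crossings. -/
def FarZoneSingleTurningPoint : Prop :=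
  ∀ (M b r : ℝ), 0 ≤ M → 3 * M < r → 0 < b →
    HasDerivAt (fun s : ℝ ↦ 1 - b ^ 2 / s ^ 2 + 2 * M * b ^ 2 / s ^ 3)
      (2 * b ^ 2 * (r - 3 * M) / r ^ 4) r ∧ 0 < 2 * b ^ 2 * (r - 3 * M) / r ^ 4

end Summit.FinalStateConjecture.FinalStateConjecture.Cruxes.NecksCertify.IdeateR1K3

end
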